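import Summits.QuantumFields.YangMills.Theorems.UV3BranchExpansionDomination
import HarnessLib

/-!
# R3 (cell `ym3-torus`, YM₃ on T³ — a ladder RUNG, NOT d = 4, NOT infinite volume, NOT a mass gap, NOT the Clay problem) —
# **(T2) THE GHOST EXPANSION OF ONE FIRING PATTERN: `1_{pat = Γ} = Σ_{G ⊆ Γᶜ} (−1)^{|G|}·1_{Z_{Γ∪G}}` pointwise, as signed measures of sets under a FIXED map,
# and against integrable test functions (abstract, def-free)**

Width seat `ym3-torus-px8` g13 on crux `stmt-QuantumFields-19936` `UnitScaleTilt.HistoryTailL` (`--supports`, helper; THEOREMS ONLY, 0 `def`, 0 `sorry`,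
default heartbeats).  Item (T2) of dag-n08-d g47's architecture memo `pub-ymgap/pub-ymgap-dag-n08-d/N08-HJ-M6-CANCELLATION-g47.md` §1 (E2) ∕ §5, handed to px8
(ym3-torus INBOX 2026-08-30T03:46:32Z).  RECORD CURRENCY: record-independent bookkeeping for hTop (read by no row of the χ record `AlphaInputsT3ACv4RecChi`).

THE IDENTITY.  On a finite measure space `(Ω, μ)` (a level-`j` term of the Markov tower (E3) — NOT necessarily product Haar) with a finite family of
«large-field» events `Z : ι → Set Ω` (one per coarse bond of the next level) the exact firing pattern `Γ` is the event `{ω | ∀ c, c ∈ Γ ↔ ω ∈ Z c}`; expanding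
ONLY the unfired constraints `∏_{c ∉ Γ} (1 − 1_{Z c})` by inclusion–exclusion gives, for every FIXED measurable map `f : Ω → Y` (the hybrid step `Hyb_Γ`),
  `μ({pat = Γ} ∩ f⁻¹B) = Σ_{G ⊆ Γᶜ} (−1)^{|G|} · μ((⋂_{c ∈ Γ ∪ G} Z c) ∩ f⁻¹B)`   (signed, exact; the bonds of `G` are the GHOSTS: weight `1_{Z c}`, map unmodified).
* §1 `pattern_eq_iff` (the pattern event in LEAD ★w1 g12's letters: `S ω = Γ ↔ ∀ c, c ∈ Γ ↔ ω ∈ Z c` with `S ω := univ.filter (ω ∈ Z ·)`), ★ `indicator_pattern_eq_sum`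
  (POINTWISE form, over ✓`UV3BranchExpansionDomination.indicator_fiber_eq_prod` at history-INDEPENDENT events + ✓`UV3BranchExpansionKernels.prod_one_sub_eq_sum_powerset`).
* §2 ★★ `measureReal_pattern_inter_preimage_eq_sum` (SET ∕ PUSH-FORWARD form above), `measureReal_pattern_eq_sum` (`B = univ`).
* §3 ★★ `integral_indicator_pattern_mul_eq_sum` (TEST-FUNCTION form `∫ 1_{pat=Γ}·φ dμ = Σ_G (−1)^{|G|} ∫ 1_{Z_{Γ∪G}}·φ dμ`, `φ` integrable — with `φ = g ∘ Hyb_Γ`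
  this is (E2) «linear in the density, map fixed» verbatim), `setIntegral_pattern_eq_sum`.
* §4 (T4) `sum_powerset_neg_one_pow_card_sdiff_eq_zero` (`Σ_{T ⊆ A} (−1)^{|A ∖ T|} = 0` for `A ≠ ∅`) — the instance `f := 1` of LEAD's
  ✓`UV3BranchExpansionKernels.alternatingSum_powerset_eq_zero_of_pairing`, which IS the memo's (T3)+(T4) «top-independence kills the finished cluster» by name.
RELATION TO LEAD's (E) ✓`UV3BranchExpansionDomination.measureReal_preimage_actual_eq_branchExpansion`: that theorem is the SUM over all `Γ` of §2 with
history-dependent events; §2 is the per-`Γ` fibre identity (history-independent events, one fixed map), exported for the level-by-level Markov form (E1)–(E3).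

HONEST SCOPE.  [folklore] finite inclusion–exclusion + integration of a pointwise identity; nothing of hTop ∕ (M6′) ∕ the χ record's rows ∕ (O‴χₛ) ∕ `HistoryTailL`
(19936) ∕ N08 (27364) ∕ the rung is proved; rung R3 = SU(2) YM₃ on T³ — NOT d = 4, NOT infinite volume, NOT a mass gap, NOT Clay; the Yang–Mills mass gap is NOT proved.

References: T. Bałaban, Commun. Math. Phys. **109** (1987) 249–301 [Balaban1987RG1] ((0.4) p. 253, the small-field guard and its two branches); dag-n08-d g47
`N08-HJ-M6-CANCELLATION-g47.md` §1 (E2); LEAD note `Cruxes/HistoryTailL/HTopBranchExpansion.md` §2 (E).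
-/

set_option autoImplicit false

noncomputable section

open MeasureTheory Set
open scoped ENNReal

namespace Summit.QuantumFields.YangMills.Theorems.UV3GhostExpansion

open Summit.QuantumFields.YangMills.Theorems.UV3BranchExpansionKernels (prod_one_sub_eq_sum_powerset alternatingSum_powerset_eq_zero_of_pairing)
open Summit.QuantumFields.YangMills.Theorems.UV3BranchExpansionDomination (indicator_fiber_eq_prod prod_indicator_mul_indicator_preimage)

/-! ## §1 The pattern event and the pointwise ghost expansion -/
section Pointwise

variable {Ω ι : Type*} [Fintype ι] [DecidableEq ι] (Z : ι → Set Ω)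

omit [DecidableEq ι] in
/-- The firing pattern as a finset-valued map: `S ω = Γ ↔ ∀ c, c ∈ Γ ↔ ω ∈ Z c` for `S ω := univ.filter (ω ∈ Z ·)` (LEAD's `hS` at history-independent events). [folklore] -/
theorem pattern_eq_iff [∀ c ω, Decidable (ω ∈ Z c)] (ω : Ω) (Γ : Finset ι) :
    Finset.univ.filter (fun c => ω ∈ Z c) = Γ ↔ ∀ c, (c ∈ Γ ↔ ω ∈ Z c) := by
  constructor
  · rintro rfl c
    simp
  · intro h
    ext c
    simp [h c]

/-- The pattern event `{ω | ∀ c, c ∈ Γ ↔ ω ∈ Z c}` is the intersection of `Z c` (`c ∈ Γ`) and `(Z c)ᶜ` (`c ∉ Γ`), hence measurable. [folklore] -/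
theorem measurableSet_pattern [MeasurableSpace Ω] (hZ : ∀ c, MeasurableSet (Z c)) (Γ : Finset ι) :
    MeasurableSet {ω : Ω | ∀ c, (c ∈ Γ ↔ ω ∈ Z c)} := by
  have hset : {ω : Ω | ∀ c, (c ∈ Γ ↔ ω ∈ Z c)} = ⋂ c : ι, (if c ∈ Γ then Z c else (Z c)ᶜ) := by
    ext ω
    simp only [mem_setOf_eq, mem_iInter]
    refine forall_congr' fun c => ?_
    by_cases hc : c ∈ Γ
    · simp [hc]
    · simp [hc]
  rw [hset]
  refine MeasurableSet.iInter fun c => ?_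
  by_cases hc : c ∈ Γ
  · rw [if_pos hc]; exact hZ c
  · rw [if_neg hc]; exact (hZ c).compl

/-- ★ **THE GHOST EXPANSION, POINTWISE**: `1_{pat = Γ}(ω) = Σ_{G ⊆ Γᶜ} (−1)^{|G|} · 1_{⋂_{c ∈ Γ ∪ G} Z c}(ω)` — the fired constraints kept as indicators, the unfired ones
`∏_{c∉Γ}(1 − 1_{Z c})` expanded; the bonds of `G` are the ghosts. [cite: Balaban1987RG1, (0.4) p.253] -/
theorem indicator_pattern_eq_sum (Γ : Finset ι) (ω : Ω) :
    ({ω : Ω | ∀ c, (c ∈ Γ ↔ ω ∈ Z c)}).indicator (1 : Ω → ℝ) ω =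
      ∑ G ∈ (Finset.univ \ Γ).powerset, (-1 : ℝ) ^ G.card * (⋂ c ∈ Γ ∪ G, Z c).indicator (1 : Ω → ℝ) ω := by
  classical
  -- LEAD's fibre product at history-independent events `F σ _ := Z σ`, `S ω := univ.filter (ω ∈ Z ·)`
  have hS : ∀ (ω : Ω) (s : Finset ι), Finset.univ.filter (fun c => ω ∈ Z c) = s ↔ ∀ σ, (σ ∈ s ↔ ω ∈ (fun σ (_ : Finset ι) => Z σ) σ s) :=
    fun ω s => pattern_eq_iff Z ω s
  have hfib := indicator_fiber_eq_prod (fun σ (_ : Finset ι) => Z σ) (fun ω => Finset.univ.filter (fun c => ω ∈ Z c)) hS Γ ω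
  have hev : {ω : Ω | Finset.univ.filter (fun c => ω ∈ Z c) = Γ} = {ω : Ω | ∀ c, (c ∈ Γ ↔ ω ∈ Z c)} := by
    ext ω; exact pattern_eq_iff Z ω Γ
  rw [hev] at hfib
  rw [hfib, prod_one_sub_eq_sum_powerset, Finset.mul_sum]
  refine Finset.sum_congr rfl fun G hG => ?_
  have hG' : G ⊆ Finset.univ \ Γ := Finset.mem_powerset.1 hG
  have hdis : Disjoint Γ G := by
    rw [Finset.disjoint_left]
    intro c hc hcG
    exact (Finset.mem_sdiff.1 (hG' hcG)).2 hc
  have hprod : (⋂ c ∈ Γ ∪ G, Z c).indicator (1 : Ω → ℝ) ω = ∏ c ∈ Γ ∪ G, (Z c).indicator (1 : Ω → ℝ) ω := by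
    have h := prod_indicator_mul_indicator_preimage (Γ ∪ G) Z (id : Ω → Ω) (univ : Set Ω) ω
    rw [preimage_univ, indicator_of_mem (mem_univ ω), Pi.one_apply, mul_one, inter_univ] at h
    exact h.symm
  rw [hprod, Finset.prod_union hdis]
  ring

end Pointwise

/-! ## §2 The ghost expansion as a signed identity of measures of sets under a fixed map -/
section SetForm

variable {Ω Y ι : Type*} [MeasurableSpace Ω] [MeasurableSpace Y] [Fintype ι] [DecidableEq ι]
  (μ : Measure Ω) [IsFiniteMeasure μ] (Z : ι → Set Ω) (f : Ω → Y)

/-- ★★ **THE GHOST EXPANSION UNDER A FIXED MAP** ((E2) per pattern): for every fired set `Γ`, every measurable `f` (the hybrid step `Hyb_Γ`) and every measurable `B`,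
`μ({pat = Γ} ∩ f⁻¹B) = Σ_{G ⊆ Γᶜ} (−1)^{|G|} · μ((⋂_{c ∈ Γ ∪ G} Z c) ∩ f⁻¹B)` — «linear in the density, map fixed»: the push-forward of `1_{pat=Γ}·μ` by `f` is the signed
combination of the push-forwards of `1_{Z_{Γ∪G}}·μ` by the SAME `f`. [cite: Balaban1987RG1, (0.4) p.253] -/
theorem measureReal_pattern_inter_preimage_eq_sum (hZ : ∀ c, MeasurableSet (Z c)) (hf : Measurable f) (Γ : Finset ι) {B : Set Y} (hB : MeasurableSet B) :
    μ.real ({ω : Ω | ∀ c, (c ∈ Γ ↔ ω ∈ Z c)} ∩ f ⁻¹' B) =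
      ∑ G ∈ (Finset.univ \ Γ).powerset, (-1 : ℝ) ^ G.card * μ.real ((⋂ c ∈ Γ ∪ G, Z c) ∩ f ⁻¹' B) := by
  have hP : MeasurableSet {ω : Ω | ∀ c, (c ∈ Γ ↔ ω ∈ Z c)} := measurableSet_pattern Z hZ Γ
  have hE : ∀ G : Finset ι, MeasurableSet ((⋂ c ∈ Γ ∪ G, Z c) ∩ f ⁻¹' B) := fun G =>
    ((Γ ∪ G).measurableSet_biInter fun c _ => hZ c).inter (hf hB)
  -- pointwise: multiply §1 by `1_{f⁻¹B}`
  have hpt : ∀ ω : Ω, ({ω : Ω | ∀ c, (c ∈ Γ ↔ ω ∈ Z c)} ∩ f ⁻¹' B).indicator (1 : Ω → ℝ) ω =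
      ∑ G ∈ (Finset.univ \ Γ).powerset, (-1 : ℝ) ^ G.card * ((⋂ c ∈ Γ ∪ G, Z c) ∩ f ⁻¹' B).indicator (1 : Ω → ℝ) ω := by
    intro ω
    rw [Set.inter_indicator_one, Pi.mul_apply, indicator_pattern_eq_sum Z Γ ω, Finset.sum_mul]
    refine Finset.sum_congr rfl fun G _ => ?_
    rw [Set.inter_indicator_one, Pi.mul_apply]
    ring
  have hint : ∀ G : Finset ι, Integrable (fun ω => (-1 : ℝ) ^ G.card * ((⋂ c ∈ Γ ∪ G, Z c) ∩ f ⁻¹' B).indicator (1 : Ω → ℝ) ω) μ := fun G =>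
    ((integrable_const (1 : ℝ)).indicator (hE G)).const_mul _
  calc μ.real ({ω : Ω | ∀ c, (c ∈ Γ ↔ ω ∈ Z c)} ∩ f ⁻¹' B)
      = ∫ ω, ({ω : Ω | ∀ c, (c ∈ Γ ↔ ω ∈ Z c)} ∩ f ⁻¹' B).indicator (1 : Ω → ℝ) ω ∂μ := (integral_indicator_one (hP.inter (hf hB))).symm
    _ = ∫ ω, ∑ G ∈ (Finset.univ \ Γ).powerset, (-1 : ℝ) ^ G.card * ((⋂ c ∈ Γ ∪ G, Z c) ∩ f ⁻¹' B).indicator (1 : Ω → ℝ) ω ∂μ :=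
        integral_congr_ae (Filter.Eventually.of_forall hpt)
    _ = ∑ G ∈ (Finset.univ \ Γ).powerset, (-1 : ℝ) ^ G.card * μ.real ((⋂ c ∈ Γ ∪ G, Z c) ∩ f ⁻¹' B) := by
        rw [integral_finsetSum _ fun G _ => hint G]
        refine Finset.sum_congr rfl fun G _ => ?_
        rw [integral_const_mul, integral_indicator_one (hE G)]

/-- **MASS FORM** (`B = univ`): `μ{pat = Γ} = Σ_{G ⊆ Γᶜ} (−1)^{|G|} μ(⋂_{c∈Γ∪G} Z c)`. [folklore] -/
theorem measureReal_pattern_eq_sum (hZ : ∀ c, MeasurableSet (Z c)) (Γ : Finset ι) :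
    μ.real {ω : Ω | ∀ c, (c ∈ Γ ↔ ω ∈ Z c)} = ∑ G ∈ (Finset.univ \ Γ).powerset, (-1 : ℝ) ^ G.card * μ.real (⋂ c ∈ Γ ∪ G, Z c) := by
  have h := measureReal_pattern_inter_preimage_eq_sum μ Z (id : Ω → Ω) hZ measurable_id Γ MeasurableSet.univ
  simpa only [preimage_univ, inter_univ] using h

/-- **PUSH-FORWARD FORM**: `((μ↾{pat = Γ}).map f).real B = Σ_{G ⊆ Γᶜ} (−1)^{|G|}·((μ↾⋂_{c∈Γ∪G} Z c).map f).real B`. [cite: Balaban1987RG1, (0.4) p.253] -/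
theorem map_restrict_pattern_real_eq_sum (hZ : ∀ c, MeasurableSet (Z c)) (hf : Measurable f) (Γ : Finset ι) {B : Set Y} (hB : MeasurableSet B) :
    ((μ.restrict {ω : Ω | ∀ c, (c ∈ Γ ↔ ω ∈ Z c)}).map f).real B =
      ∑ G ∈ (Finset.univ \ Γ).powerset, (-1 : ℝ) ^ G.card * ((μ.restrict (⋂ c ∈ Γ ∪ G, Z c)).map f).real B := by
  have hP : MeasurableSet {ω : Ω | ∀ c, (c ∈ Γ ↔ ω ∈ Z c)} := measurableSet_pattern Z hZ Γ
  rw [measureReal_def, Measure.map_apply hf hB, Measure.restrict_apply' hP, inter_comm, ← measureReal_def,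
    measureReal_pattern_inter_preimage_eq_sum μ Z f hZ hf Γ hB]
  refine Finset.sum_congr rfl fun G _ => ?_
  rw [measureReal_def (μ := ((μ.restrict (⋂ c ∈ Γ ∪ G, Z c)).map f)), Measure.map_apply hf hB,
    Measure.restrict_apply' ((Γ ∪ G).measurableSet_biInter fun c _ => hZ c), inter_comm, ← measureReal_def]

end SetForm

/-! ## §3 The ghost expansion against integrable test functions -/
section IntegralForm

variable {Ω ι : Type*} [MeasurableSpace Ω] [Fintype ι] [DecidableEq ι] (μ : Measure Ω) (Z : ι → Set Ω)

/-- ★★ **TEST-FUNCTION FORM**: for every integrable `φ`, `∫ 1_{pat=Γ}·φ dμ = Σ_{G ⊆ Γᶜ} (−1)^{|G|} ∫ 1_{⋂_{c∈Γ∪G} Z c}·φ dμ`.  With `φ = g ∘ Hyb_Γ` (a bounded test function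
of the hybrid output) this is the weighted push-forward identity (E2) `(1_{pat=Γ}·μ).map Hyb_Γ = Σ_G (−1)^{|G∖Γ|} (1_{Z_G}·μ).map Hyb_Γ`, tested. [cite: Balaban1987RG1, (0.4) p.253] -/
theorem integral_indicator_pattern_mul_eq_sum (hZ : ∀ c, MeasurableSet (Z c)) (Γ : Finset ι) {φ : Ω → ℝ} (hφ : Integrable φ μ) :
    ∫ ω, ({ω : Ω | ∀ c, (c ∈ Γ ↔ ω ∈ Z c)}).indicator (1 : Ω → ℝ) ω * φ ω ∂μ =
      ∑ G ∈ (Finset.univ \ Γ).powerset, (-1 : ℝ) ^ G.card * ∫ ω, (⋂ c ∈ Γ ∪ G, Z c).indicator (1 : Ω → ℝ) ω * φ ω ∂μ := by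
  have hE : ∀ G : Finset ι, MeasurableSet (⋂ c ∈ Γ ∪ G, Z c) := fun G => (Γ ∪ G).measurableSet_biInter fun c _ => hZ c
  have hpt : ∀ ω : Ω, ({ω : Ω | ∀ c, (c ∈ Γ ↔ ω ∈ Z c)}).indicator (1 : Ω → ℝ) ω * φ ω =
      ∑ G ∈ (Finset.univ \ Γ).powerset, (-1 : ℝ) ^ G.card * ((⋂ c ∈ Γ ∪ G, Z c).indicator (1 : Ω → ℝ) ω * φ ω) := by
    intro ω
    rw [indicator_pattern_eq_sum Z Γ ω, Finset.sum_mul]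
    refine Finset.sum_congr rfl fun G _ => ?_
    ring
  -- each summand is integrable: an indicator of a measurable set times an integrable function
  have hint : ∀ G : Finset ι, Integrable (fun ω => (-1 : ℝ) ^ G.card * ((⋂ c ∈ Γ ∪ G, Z c).indicator (1 : Ω → ℝ) ω * φ ω)) μ := by
    intro G
    have h1 : Integrable (fun ω => (⋂ c ∈ Γ ∪ G, Z c).indicator (1 : Ω → ℝ) ω * φ ω) μ := by
      have heq : (fun ω => (⋂ c ∈ Γ ∪ G, Z c).indicator (1 : Ω → ℝ) ω * φ ω) = (⋂ c ∈ Γ ∪ G, Z c).indicator φ := by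
        funext ω
        by_cases hω : ω ∈ ⋂ c ∈ Γ ∪ G, Z c
        · rw [indicator_of_mem hω, indicator_of_mem hω, Pi.one_apply, one_mul]
        · rw [indicator_of_notMem hω, indicator_of_notMem hω, zero_mul]
      rw [heq]
      exact hφ.indicator (hE G)
    exact h1.const_mul _
  calc ∫ ω, ({ω : Ω | ∀ c, (c ∈ Γ ↔ ω ∈ Z c)}).indicator (1 : Ω → ℝ) ω * φ ω ∂μ
      = ∫ ω, ∑ G ∈ (Finset.univ \ Γ).powerset, (-1 : ℝ) ^ G.card * ((⋂ c ∈ Γ ∪ G, Z c).indicator (1 : Ω → ℝ) ω * φ ω) ∂μ :=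
        integral_congr_ae (Filter.Eventually.of_forall hpt)
    _ = ∑ G ∈ (Finset.univ \ Γ).powerset, (-1 : ℝ) ^ G.card * ∫ ω, (⋂ c ∈ Γ ∪ G, Z c).indicator (1 : Ω → ℝ) ω * φ ω ∂μ := by
        rw [integral_finsetSum _ fun G _ => hint G]
        refine Finset.sum_congr rfl fun G _ => ?_
        rw [integral_const_mul]

/-- **SET-INTEGRAL FORM**: `∫_{pat=Γ} φ dμ = Σ_{G ⊆ Γᶜ} (−1)^{|G|} ∫_{⋂_{c∈Γ∪G} Z c} φ dμ` for integrable `φ`. [cite: Balaban1987RG1, (0.4) p.253] -/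
theorem setIntegral_pattern_eq_sum (hZ : ∀ c, MeasurableSet (Z c)) (Γ : Finset ι) {φ : Ω → ℝ} (hφ : Integrable φ μ) :
    ∫ ω in {ω : Ω | ∀ c, (c ∈ Γ ↔ ω ∈ Z c)}, φ ω ∂μ =
      ∑ G ∈ (Finset.univ \ Γ).powerset, (-1 : ℝ) ^ G.card * ∫ ω in ⋂ c ∈ Γ ∪ G, Z c, φ ω ∂μ := by
  have hP : MeasurableSet {ω : Ω | ∀ c, (c ∈ Γ ↔ ω ∈ Z c)} := measurableSet_pattern Z hZ Γ
  have hE : ∀ G : Finset ι, MeasurableSet (⋂ c ∈ Γ ∪ G, Z c) := fun G => (Γ ∪ G).measurableSet_biInter fun c _ => hZ c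
  have hmul : ∀ (E : Set Ω), MeasurableSet E → ∫ ω, E.indicator (1 : Ω → ℝ) ω * φ ω ∂μ = ∫ ω in E, φ ω ∂μ := by
    intro E hEm
    rw [← integral_indicator hEm]
    refine integral_congr_ae (Filter.Eventually.of_forall fun ω => ?_)
    by_cases hω : ω ∈ E
    · simp only [indicator_of_mem hω, Pi.one_apply, one_mul]
    · simp only [indicator_of_notMem hω, zero_mul]
  rw [← hmul _ hP, integral_indicator_pattern_mul_eq_sum μ Z hZ Γ hφ]
  refine Finset.sum_congr rfl fun G _ => ?_
  rw [hmul _ (hE G)]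

end IntegralForm

/-! ## §4 (T4) The alternating sum over the subsets of a non-empty set vanishes -/
section Alternating

variable {ι : Type*} [DecidableEq ι]

/-- **(T4)** `Σ_{T ⊆ A} (−1)^{|A ∖ T|} = 0` for `A ≠ ∅` — the instance `f := 1` of LEAD's ✓`alternatingSum_powerset_eq_zero_of_pairing`; with a summand `f T` that
does not see whether one fixed `σ ∈ A` belongs to `T` (the memo's (T3) «top-independence of the finished cluster's mass») that lemma gives `Σ_T (−1)^{|A∖T|} f T = 0`
directly. [folklore] -/
theorem sum_powerset_neg_one_pow_card_sdiff_eq_zero (A : Finset ι) (hA : A.Nonempty) :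
    ∑ T ∈ A.powerset, (-1 : ℝ) ^ (A \ T).card = 0 := by
  obtain ⟨σ, hσ⟩ := hA
  have h := alternatingSum_powerset_eq_zero_of_pairing A (fun _ => (1 : ℝ)) hσ fun _ _ _ => rfl
  simpa only [mul_one] using h

/-- **(T3)+(T4) IN THE MEMO's LETTERS**: if the mass `m T` of a finished cluster `A` fired on `T ⊆ A` does not depend on whether the top bond `σ ∈ A` fires, the
cluster's signed activity `Σ_{T ⊆ A} (−1)^{|A∖T|} m T` is ZERO (LEAD's pairing lemma, re-exported under the memo's name). [folklore] -/
theorem cluster_activity_eq_zero_of_top_independent (A : Finset ι) (m : Finset ι → ℝ) {σ : ι} (hσ : σ ∈ A)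
    (htop : ∀ T ⊆ A, σ ∉ T → m (insert σ T) = m T) :
    ∑ T ∈ A.powerset, (-1 : ℝ) ^ (A \ T).card * m T = 0 :=
  alternatingSum_powerset_eq_zero_of_pairing A m hσ htop

end Alternating

end Summit.QuantumFields.YangMills.Theorems.UV3GhostExpansion

end
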